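import Summits.QuantumFields.YangMills.Theorems.IR.SCFloorOffDiagSchwarz
import Summits.QuantumFields.YangMills.Theorems.IR.SCFloorClusteringPoly
import Summits.QuantumFields.YangMills.Theorems.IR.SCFloorLatticeSums
import Summits.QuantumFields.YangMills.Theorems.IR.SCFloorFacingPlaquette

/-!
# Strong-coupling floor engine, part 18: the terms of the plaquette slice sums `s(t) = Σ_{x⃗} Corr(P∘θ_{(0,x⃗)}, P; t)`

Pooled prover `ym-ir-line-bsf-p1` (crux `IR`, stmt-QuantumFields-19354), support for the consumer rung R2 of line
`momentum-pincer` (`NoLightMoversSCTransfer`; `sliceSumCorr` of `Lines/momentum_pincer.lean` §1, written out).  With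
`P = plaquetteObs ρ 0 1 2` and `θ_v = configShift v` on `ℤ⁴`-configurations, torus `(ℤ/(2S+1))⁴`:
* §1 `latticeConnectedCorr_shift_eq` — by torus translation invariance the term of the slice sum is the two-point
  function `g(x) = ⟨P · P∘θ_x⟩ − ⟨P⟩⟨P∘θ_x⟩` at the relative displacement `x = −t e₀ − v`;
* §2 `twoPoint_plaquette_eq_cov` — `g(x)` is the torus covariance of `Re tr ρ(U_{(0;1,2)})` and `Re tr ρ(U_{(−x mod;1,2)})`;
* §3 `offdiag_term_bound` — for `t = 1` and `x⃗ ≠ 0⃗`: `|term| ≤ M β⁵ ∏ᵢ (1/2)^{|x̃ᵢ|}` (near displacements by the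
  volume-uniform `O(β⁵)` bound of part 15, far ones by the polynomial clustering of part 16, both dominated by the
  product weight via part 17), and `equalTime_term_bound` — for `t = 0`: `|term| ≤ M ∏ᵢ (1/2)^{|x̃ᵢ|}`.
HONEST: strong coupling only; nothing here bears on the Yang–Mills mass gap.
-/

set_option autoImplicit false

noncomputable section

open MeasureTheory Filter Topology Function Finset
open Literature.MathematicalPhysics.QuantumFieldTheory
open Literature.MathematicalPhysics.QuantumLattice (plaquetteObs torusLift toTorusObservable configShift configShift_apply
  LGConfig IsCylinder)
open Literature.Probability.LatticeModels (Torus.proj Torus.proj_apply)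
open Literature.Probability.LatticeModels.Site (supNorm supNorm_le_iff natAbs_le_supNorm norm_eq_supNorm)

namespace Summit.QuantumFields.YangMills.Cruxes.IR.SCFloor

variable {G : Type} [Group G] [TopologicalSpace G] [IsTopologicalGroup G] [CompactSpace G] [MeasurableSpace G]
  [BorelSpace G] {N : ℕ} (ρ : G →* Matrix (Fin N) (Fin N) ℂ)

/-! ## §1 Translation invariance: the slice-sum term as a two-point function of the relative displacement -/

/-- Torus translation invariance of the Wilson state for a shifted `ℤ⁴`-observable. -/
theorem wilsonExpectation_toTorusObservable_configShift (L : ℕ) [NeZero L] (β : ℝ) (F : LGConfig 4 G → ℝ)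
    (v : Literature.Probability.LatticeModels.Site 4) :
    wilsonExpectation (L := L) ρ β (toTorusObservable L (F ∘ configShift v)) =
      wilsonExpectation (L := L) ρ β (toTorusObservable L F) := by
  rw [toTorusObservable_comp_configShift, wilsonExpectation_comp_torusConfigShift]

/-- **The slice-sum term as a two-point function.**  For a `ℤ⁴`-observable `F`, a translation `v` and a time `t`:
`Corr_L(F∘θ_v, F; t) = ⟨F · F∘θ_x⟩_L − ⟨F⟩_L ⟨F∘θ_x⟩_L` with `x = −t e₀ − v`. -/
theorem latticeConnectedCorr_shift_eq (L : ℕ) [NeZero L] (β : ℝ) (F : LGConfig 4 G → ℝ)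
    (v : Literature.Probability.LatticeModels.Site 4) (t : ℕ) :
    latticeConnectedCorr ρ β L (fun U => F (configShift v U)) F t =
      wilsonExpectation (L := L) ρ β
          (toTorusObservable L fun U => F U * F (configShift (-Pi.single 0 (t : ℤ) - v) U)) -
        wilsonExpectation (L := L) ρ β (toTorusObservable L F) *
          wilsonExpectation (L := L) ρ β (toTorusObservable L (F ∘ configShift (-Pi.single 0 (t : ℤ) - v))) := by
  rw [Summit.QuantumFields.YangMills.Theorems.SoloBlind.latticeConnectedCorr_eq_wilsonExpectation]
  have h1 : (fun U => F (configShift v U) * F (configShift (-Pi.single 0 (t : ℤ)) U)) =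
      (fun W => F W * F (configShift (-Pi.single 0 (t : ℤ) - v) W)) ∘ configShift v := by
    funext U
    have hcomp : configShift (-Pi.single 0 (t : ℤ) - v) (configShift v U) = configShift (-Pi.single 0 (t : ℤ)) U := by
      funext e; simp only [configShift_apply, sub_sub, sub_add_cancel]
    simp only [Function.comp_apply, hcomp]
  have h2 : (fun U => F (configShift v U)) = F ∘ configShift v := rfl
  rw [h1, h2, wilsonExpectation_toTorusObservable_configShift, wilsonExpectation_toTorusObservable_configShift,
    wilsonExpectation_toTorusObservable_configShift]

/-! ## §2 The two-point function of the plaquette as a torus covariance -/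

/-- `⟨P · P∘θ_x⟩_L − ⟨P⟩_L⟨P∘θ_x⟩_L` for `P = plaquetteObs ρ 0 1 2` is the covariance, under the torus Wilson measure, of
`Re tr ρ(U_{(0;1,2)})` and `Re tr ρ(U_{(y;1,2)})` with `y = (−x) mod L`. -/
theorem twoPoint_plaquette_eq_cov (L : ℕ) [NeZero L] (β : ℝ) (x : Literature.Probability.LatticeModels.Site 4) :
    wilsonExpectation (L := L) ρ β (toTorusObservable L fun U : LGConfig 4 G =>
          plaquetteObs ρ (0 : Literature.Probability.LatticeModels.Site 4) 1 2 U *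
            plaquetteObs ρ (0 : Literature.Probability.LatticeModels.Site 4) 1 2 (configShift x U)) -
        wilsonExpectation (L := L) ρ β
            (toTorusObservable L (plaquetteObs ρ (0 : Literature.Probability.LatticeModels.Site 4) 1 2)) *
          wilsonExpectation (L := L) ρ β (toTorusObservable L
            (plaquetteObs ρ (0 : Literature.Probability.LatticeModels.Site 4) 1 2 ∘ configShift x)) =
      (∫ U, (ρ (plaquetteHolonomy U 0 1 2)).trace.re * (ρ (plaquetteHolonomy U (Torus.proj L (-x)) 1 2)).trace.re
          ∂(wilsonMeasure (d := 4) (L := L) ρ β)) -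
        (∫ U, (ρ (plaquetteHolonomy U 0 1 2)).trace.re ∂(wilsonMeasure (d := 4) (L := L) ρ β)) *
          ∫ U, (ρ (plaquetteHolonomy U (Torus.proj L (-x)) 1 2)).trace.re ∂(wilsonMeasure (d := 4) (L := L) ρ β) := by
  have hshift : (plaquetteObs ρ (0 : Literature.Probability.LatticeModels.Site 4) 1 2 ∘ configShift x :
      LGConfig 4 G → ℝ) = plaquetteObs ρ (-x) 1 2 := by
    funext U
    simp only [Function.comp_apply, Literature.Barriers.QuantumFields.plaquetteObs_configShift, zero_sub]
  have hp0 : (Torus.proj L (0 : Literature.Probability.LatticeModels.Site 4) : Site 4 L) = 0 := by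
    funext k; simp [Torus.proj_apply]
  have h0 := toTorusObservable_plaquetteObs_eq (L := L) ρ 0 1 2
  rw [hp0] at h0
  have hx := toTorusObservable_plaquetteObs_eq (L := L) ρ (-x) 1 2
  have hprod : (toTorusObservable L fun U : LGConfig 4 G =>
      plaquetteObs ρ (0 : Literature.Probability.LatticeModels.Site 4) 1 2 U *
        plaquetteObs ρ (0 : Literature.Probability.LatticeModels.Site 4) 1 2 (configShift x U)) =
      fun U : GaugeConfig 4 L G => (ρ (plaquetteHolonomy U 0 1 2)).trace.re *
        (ρ (plaquetteHolonomy U (Torus.proj L (-x)) 1 2)).trace.re := by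
    funext U
    have e0 := congrFun h0 U
    have ex := congrFun hx U
    have es := congrFun hshift (torusLift L U)
    simp only [toTorusObservable, Function.comp_apply] at e0 ex es ⊢
    rw [es, e0, ex]
  rw [hprod, hshift, h0, hx]
  simp only [wilsonExpectation]

/-! ## §3 Bounds on the terms of the slice sums -/

/-- Coordinates of the relative displacement `x = −t e₀ − (0, x̃)`: `|x̃ᵢ| ≤ ‖x‖_∞ ≤ S` (for `t ≤ S`), so the
displacement is admissible on the torus of side `2S+1`. -/
theorem displacement_facts (S t : ℕ) (ht : t ≤ S) (xs : Fin 3 → ZMod (2 * S + 1)) :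
    (∀ i : Fin 3, ((xs i).valMinAbs).natAbs ≤
        supNorm (-Pi.single 0 (t : ℤ) - (fun i : Fin 4 => if h : i = 0 then (0 : ℤ) else ((xs (i.pred h)).valMinAbs : ℤ)))) ∧
      supNorm (-Pi.single 0 (t : ℤ) - (fun i : Fin 4 => if h : i = 0 then (0 : ℤ) else ((xs (i.pred h)).valMinAbs : ℤ))) ≤ S ∧
      2 * ‖(-Pi.single 0 (t : ℤ) - (fun i : Fin 4 => if h : i = 0 then (0 : ℤ) else ((xs (i.pred h)).valMinAbs : ℤ)))‖ <
        ((2 * S : ℕ) : ℝ) + 1 := by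
  set x : Literature.Probability.LatticeModels.Site 4 :=
    -Pi.single 0 (t : ℤ) - (fun i : Fin 4 => if h : i = 0 then (0 : ℤ) else ((xs (i.pred h)).valMinAbs : ℤ)) with hx
  have hxs : ∀ i : Fin 3, x i.succ = -((xs i).valMinAbs : ℤ) := fun i => by
    simp [hx, Fin.succ_ne_zero]
  have hx0 : x 0 = -(t : ℤ) := by simp [hx]
  have hvS : ∀ i : Fin 3, ((xs i).valMinAbs).natAbs ≤ S := fun i => by
    have := ZMod.natAbs_valMinAbs_le (xs i); omega
  have h1 : ∀ i : Fin 3, ((xs i).valMinAbs).natAbs ≤ supNorm x := fun i => by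
    have h := natAbs_le_supNorm x i.succ
    rwa [hxs, Int.natAbs_neg] at h
  have h2 : supNorm x ≤ S := by
    rw [supNorm_le_iff]
    intro k
    rcases Fin.eq_zero_or_eq_succ k with rfl | ⟨i, rfl⟩
    · rw [hx0, Int.natAbs_neg, Int.natAbs_natCast]; exact ht
    · rw [hxs, Int.natAbs_neg]; exact hvS i
  refine ⟨h1, h2, ?_⟩
  rw [norm_eq_supNorm]
  have : ((supNorm x : ℕ) : ℝ) ≤ S := by exact_mod_cast h2
  push_cast
  linarith

/-- Far terms: the polynomial decay beats the product weight. -/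
theorem far_weight_le {q C w : ℝ} {m c : ℕ} (hC0 : 0 ≤ C) (hq0 : 0 ≤ q) (hq : q ≤ 1 / 8)
    (hwt : ((1 : ℝ) / 8) ^ (m - c) ≤ (8 : ℝ) ^ c * w) : C * q ^ (m - c) ≤ C * 8 ^ c * w :=
  calc C * q ^ (m - c) ≤ C * ((1 : ℝ) / 8) ^ (m - c) := mul_le_mul_of_nonneg_left (pow_le_pow_left₀ hq0 hq _) hC0
    _ ≤ C * ((8 : ℝ) ^ c * w) := mul_le_mul_of_nonneg_left hwt hC0
    _ = C * 8 ^ c * w := by ring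

/-- Far terms at time distance one: `C q^{m−c} ≤ (C q⁵) · 8^{c+5} w` when `m ≥ c + 5`. -/
theorem far_weight_le_five {q C w : ℝ} {m c : ℕ} (hC0 : 0 ≤ C) (hq0 : 0 ≤ q) (hq : q ≤ 1 / 8) (hm : c + 5 ≤ m)
    (hwt : ((1 : ℝ) / 8) ^ (m - (c + 5)) ≤ (8 : ℝ) ^ (c + 5) * w) :
    C * q ^ (m - c) ≤ C * q ^ 5 * ((8 : ℝ) ^ (c + 5) * w) := by
  have hsplit : q ^ (m - c) = q ^ 5 * q ^ (m - (c + 5)) := by rw [← pow_add]; congr 1; omega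
  calc C * q ^ (m - c) = C * (q ^ 5 * q ^ (m - (c + 5))) := by rw [hsplit]
    _ ≤ C * (q ^ 5 * ((1 : ℝ) / 8) ^ (m - (c + 5))) :=
        mul_le_mul_of_nonneg_left (mul_le_mul_of_nonneg_left (pow_le_pow_left₀ hq0 hq _) (pow_nonneg hq0 _)) hC0
    _ ≤ C * (q ^ 5 * ((8 : ℝ) ^ (c + 5) * w)) :=
        mul_le_mul_of_nonneg_left (mul_le_mul_of_nonneg_left hwt (pow_nonneg hq0 _)) hC0
    _ = C * q ^ 5 * ((8 : ℝ) ^ (c + 5) * w) := by ring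

/-- **Equal-time terms.**  There are `β₀ > 0` and `M` with, for all `S ≥ 1`, `0 ≤ β ≤ β₀` and `x⃗ ∈ (ℤ/(2S+1))³`:
`|Corr_{2S+1}(P∘θ_{(0,x̃)}, P; 0)| ≤ M ∏ᵢ (1/2)^{|x̃ᵢ|}` (polynomial clustering, part 16, dominated by the product weight). -/
theorem equalTime_term_bound (hρ : Continuous ρ) :
    ∃ β₀ M : ℝ, 0 < β₀ ∧ 0 ≤ M ∧ ∀ (S : ℕ), 1 ≤ S → ∀ β : ℝ, 0 ≤ β → β ≤ β₀ →
      ∀ xs : Fin 3 → ZMod (2 * S + 1),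
        |latticeConnectedCorr ρ β (2 * S + 1)
            (fun U => plaquetteObs ρ (0 : Literature.Probability.LatticeModels.Site 4) 1 2
              (configShift (fun i : Fin 4 => if h : i = 0 then (0 : ℤ) else ((xs (i.pred h)).valMinAbs : ℤ)) U))
            (plaquetteObs ρ (0 : Literature.Probability.LatticeModels.Site 4) 1 2) 0| ≤
          M * ∏ i : Fin 3, ((1 : ℝ) / 2) ^ ((xs i).valMinAbs).natAbs := by
  classical
  obtain ⟨r, hr, hpoly⟩ := torusClustering_uniform_poly (d := 4) ρ (by norm_num) hρ
  obtain ⟨Ctr, -, hCtr⟩ := exists_bound_trace_re_nonneg (ρ := ρ) hρ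
  have h12d : ((1 : Fin 4), (2 : Fin 4)).1 < ((1 : Fin 4), (2 : Fin 4)).2 := by decide
  have hPloc : Literature.MathematicalPhysics.QuantumLattice.IsLocalObservable
      (plaquetteObs ρ (0 : Literature.Probability.LatticeModels.Site 4) 1 2) :=
    ⟨_, Literature.MathematicalPhysics.QuantumLattice.isCylinder_plaquetteObs (G := G) ρ
      ((0 : Literature.Probability.LatticeModels.Site 4), ⟨((1 : Fin 4), (2 : Fin 4)), h12d⟩)⟩
  have hPm : Measurable (plaquetteObs ρ (0 : Literature.Probability.LatticeModels.Site 4) 1 2) :=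
    measurable_trace_re_plaquette ρ hρ _ 1 2
  have hPb : ∃ C, ∀ U, |plaquetteObs ρ (0 : Literature.Probability.LatticeModels.Site 4) 1 2 U| ≤ C := ⟨Ctr, fun U => hCtr _⟩
  obtain ⟨c, C, hC0, hfar⟩ := hpoly _ _ hPloc hPloc hPm hPm hPb hPb
  refine ⟨r / 8, C * 8 ^ c, by positivity, by positivity, fun S hS β hβ0 hβ xs => ?_⟩
  obtain ⟨hvi, -, h2x⟩ := displacement_facts S 0 (Nat.zero_le _) xs
  have hβr : β ≤ r := hβ.trans (by linarith)
  have hq : β / r ≤ 1 / 8 := by rw [div_le_iff₀ hr]; linarith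
  rw [latticeConnectedCorr_shift_eq]
  exact (hfar β hβ0 hβr (2 * S) _ h2x).trans
    (far_weight_le hC0 (div_nonneg hβ0 hr.le) hq (eighth_pow_sub_le_weight _ _ c hvi))

variable [SecondCountableTopology G] [T2Space G]

/-- **Off-diagonal terms at time distance one.**  There are `β₀ > 0` and `M` with, for all `S ≥ 1`, `0 ≤ β ≤ β₀` and
`x⃗ ∈ (ℤ/(2S+1))³ ∖ {0}`: `|Corr_{2S+1}(P∘θ_{(0,x̃)}, P; 1)| ≤ M β⁵ ∏ᵢ (1/2)^{|x̃ᵢ|}` — near displacements by the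
volume-uniform `O(β⁵)` bound for non-facing plaquettes (part 15), far ones by polynomial clustering (part 16). -/
theorem offdiag_term_bound (hρ : Continuous ρ) :
    ∃ β₀ M : ℝ, 0 < β₀ ∧ 0 ≤ M ∧ ∀ (S : ℕ), 1 ≤ S → ∀ β : ℝ, 0 ≤ β → β ≤ β₀ →
      ∀ xs : Fin 3 → ZMod (2 * S + 1), xs ≠ 0 →
        |latticeConnectedCorr ρ β (2 * S + 1)
            (fun U => plaquetteObs ρ (0 : Literature.Probability.LatticeModels.Site 4) 1 2
              (configShift (fun i : Fin 4 => if h : i = 0 then (0 : ℤ) else ((xs (i.pred h)).valMinAbs : ℤ)) U))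
            (plaquetteObs ρ (0 : Literature.Probability.LatticeModels.Site 4) 1 2) 1| ≤
          M * β ^ 5 * ∏ i : Fin 3, ((1 : ℝ) / 2) ^ ((xs i).valMinAbs).natAbs := by
  classical
  obtain ⟨K', r', hr', hnear⟩ := cov_offdiag_schwarz ρ hρ
  obtain ⟨r, hr, hpoly⟩ := torusClustering_uniform_poly (d := 4) ρ (by norm_num) hρ
  obtain ⟨Ctr, -, hCtr⟩ := exists_bound_trace_re_nonneg (ρ := ρ) hρ
  have h12d : ((1 : Fin 4), (2 : Fin 4)).1 < ((1 : Fin 4), (2 : Fin 4)).2 := by decide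
  have hPloc : Literature.MathematicalPhysics.QuantumLattice.IsLocalObservable
      (plaquetteObs ρ (0 : Literature.Probability.LatticeModels.Site 4) 1 2) :=
    ⟨_, Literature.MathematicalPhysics.QuantumLattice.isCylinder_plaquetteObs (G := G) ρ
      ((0 : Literature.Probability.LatticeModels.Site 4), ⟨((1 : Fin 4), (2 : Fin 4)), h12d⟩)⟩
  have hPm : Measurable (plaquetteObs ρ (0 : Literature.Probability.LatticeModels.Site 4) 1 2) :=
    measurable_trace_re_plaquette ρ hρ _ 1 2
  have hPb : ∃ C, ∀ U, |plaquetteObs ρ (0 : Literature.Probability.LatticeModels.Site 4) 1 2 U| ≤ C := ⟨Ctr, fun U => hCtr _⟩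
  obtain ⟨c, C, hC0, hfar⟩ := hpoly _ _ hPloc hPloc hPm hPm hPb hPb
  -- `K' ≥ 0`: read the bound of part 15 at `b = r'` on the torus of side `3`
  have hK'0 : 0 ≤ K' := by
    haveI : NeZero (3 : ℕ) := ⟨by norm_num⟩
    have hy0 : (((0 : Site 4 3).shift 0).shift 1) 0 = 1 := by simp [shift_apply]
    have hy : ((0 : Site 4 3).shift 0).shift 1 ≠ (0 : Site 4 3).shift 0 := fun h => by
      have := congrFun h 1; simp [shift_apply] at this
    have h := hnear 3 le_rfl _ hy0 hy r' hr'.le le_rfl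
    rw [div_self hr'.ne', one_pow, mul_one] at h
    exact (abs_nonneg _).trans h
  refine ⟨min r' (r / 8), (K' / r' ^ 5 + C / r ^ 5) * 8 ^ (c + 5), by positivity, by positivity,
    fun S hS β hβ0 hβ xs hxs => ?_⟩
  have hβr' : β ≤ r' := hβ.trans (min_le_left _ _)
  have hβr8 : β ≤ r / 8 := hβ.trans (min_le_right _ _)
  have hβr : β ≤ r := hβr8.trans (by linarith)
  have hq0 : 0 ≤ β / r := div_nonneg hβ0 hr.le
  have hq : β / r ≤ 1 / 8 := by rw [div_le_iff₀ hr]; linarith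
  obtain ⟨hvi, -, h2x⟩ := displacement_facts S 1 hS xs
  -- the torus site of the second plaquette: time `1`, not above the origin
  have hy0 : (Torus.proj (2 * S + 1) (-(-Pi.single 0 ((1 : ℕ) : ℤ) -
      (fun i : Fin 4 => if h : i = 0 then (0 : ℤ) else ((xs (i.pred h)).valMinAbs : ℤ)))) : Site 4 (2 * S + 1)) 0 = 1 := by
    simp [Torus.proj_apply]
  have hy : (Torus.proj (2 * S + 1) (-(-Pi.single 0 ((1 : ℕ) : ℤ) -
      (fun i : Fin 4 => if h : i = 0 then (0 : ℤ) else ((xs (i.pred h)).valMinAbs : ℤ)))) : Site 4 (2 * S + 1)) ≠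
      (0 : Site 4 (2 * S + 1)).shift 0 := by
    intro h
    apply hxs
    funext i
    have hi := congrFun h i.succ
    simp [Torus.proj_apply, shift_apply, Fin.succ_ne_zero] at hi
    simpa using hi
  rw [latticeConnectedCorr_shift_eq]
  have hwt := eighth_pow_sub_le_weight (fun i => ((xs i).valMinAbs : ℤ)) _ (c + 5) hvi
  generalize hX : (-Pi.single 0 ((1 : ℕ) : ℤ) - (fun i : Fin 4 => if h : i = 0 then (0 : ℤ) else ((xs (i.pred h)).valMinAbs : ℤ)) :
    Literature.Probability.LatticeModels.Site 4) = x at hvi h2x hy0 hy hwt ⊢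
  set w : ℝ := ∏ i : Fin 3, ((1 : ℝ) / 2) ^ ((xs i).valMinAbs).natAbs with hw
  have hw0 : 0 ≤ w := by rw [hw]; positivity
  -- the two available bounds
  have hpolyb := hfar β hβ0 hβr (2 * S) x h2x
  have hnearb : |wilsonExpectation (L := 2 * S + 1) ρ β (toTorusObservable (2 * S + 1) fun U : LGConfig 4 G =>
        plaquetteObs ρ (0 : Literature.Probability.LatticeModels.Site 4) 1 2 U *
          plaquetteObs ρ (0 : Literature.Probability.LatticeModels.Site 4) 1 2 (configShift x U)) -
      wilsonExpectation (L := 2 * S + 1) ρ β (toTorusObservable (2 * S + 1)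
        (plaquetteObs ρ (0 : Literature.Probability.LatticeModels.Site 4) 1 2)) *
        wilsonExpectation (L := 2 * S + 1) ρ β (toTorusObservable (2 * S + 1)
          (plaquetteObs ρ (0 : Literature.Probability.LatticeModels.Site 4) 1 2 ∘ configShift x))| ≤
      K' * (β / r') ^ 5 := by
    rw [twoPoint_plaquette_eq_cov]
    exact hnear (2 * S + 1) (by omega) _ hy0 hy β hβ0 hβr'
  have hMsplit : (K' / r' ^ 5 + C / r ^ 5) * 8 ^ (c + 5) * β ^ 5 * w =
      K' / r' ^ 5 * β ^ 5 * ((8 : ℝ) ^ (c + 5) * w) + C / r ^ 5 * β ^ 5 * ((8 : ℝ) ^ (c + 5) * w) := by ring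
  rw [hMsplit]
  have hA0 : 0 ≤ K' / r' ^ 5 * β ^ 5 * ((8 : ℝ) ^ (c + 5) * w) := by positivity
  have hB0 : 0 ≤ C / r ^ 5 * β ^ 5 * ((8 : ℝ) ^ (c + 5) * w) := by positivity
  by_cases hcase : supNorm x < c + 5
  · -- near: the `O(β⁵)` bound; the weight factor is `≥ 1`
    have h1w : (1 : ℝ) ≤ (8 : ℝ) ^ (c + 5) * w := by
      have : ((1 : ℝ) / 8) ^ (supNorm x - (c + 5)) = 1 := by rw [Nat.sub_eq_zero_of_le hcase.le, pow_zero]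
      rw [this] at hwt; exact hwt
    refine hnearb.trans (le_add_of_le_of_nonneg ?_ hB0)
    have : K' * (β / r') ^ 5 = K' / r' ^ 5 * β ^ 5 := by rw [div_pow]; ring
    rw [this]
    exact le_mul_of_one_le_right (by positivity) h1w
  · -- far: polynomial clustering
    push Not at hcase
    refine hpolyb.trans (le_add_of_nonneg_of_le hA0 ?_)
    have h := far_weight_le_five (w := w) hC0 hq0 hq hcase hwt
    have : C * (β / r) ^ 5 * ((8 : ℝ) ^ (c + 5) * w) = C / r ^ 5 * β ^ 5 * ((8 : ℝ) ^ (c + 5) * w) := by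
      rw [div_pow]; ring
    rw [← this]; exact h

end Summit.QuantumFields.YangMills.Cruxes.IR.SCFloor

end
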